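import Literature.MathematicalPhysics.QuantumFieldTheory.Balaban1983to89.T4TerritoryComparison
import Literature.MathematicalPhysics.QuantumFieldTheory.Balaban1983to89.T4TwoRunRateAssembly

/-!
# `Balaban1983to89.T4ActivityInterface` — the TYPE between territory-factor data and polymer ACTIVITIES: an activity functional of SLOT DATA with
ONE analytic field (Lipschitz for a slot gauge), the transfer «slot gauge ⇒ graded two-run rate» composed BY NAME into unit pv05's budget, the two
domination shapes unit pv06's module supplies (PRICE / two-sided RATIO) with their honest sizes, inhabited product instances (numeric and DENSITY
slots), and the LOCATED NEGATIVE «an operation's activity is not a function of its numeric territory factor» (cell `pub-balaban`, T4-DAG v15 §5 row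
U5.E-c-ACT-IFACE°, carved from unit pv05's residual G-pv05g10-1 (G-i) ≡ unit b01's G-b01g11-2; SURGE NODE PROVER #06 lineage gen 12 = the territory
owner (`T4TerritoryComparison`); imports only `T4TerritoryComparison` + `T4TwoRunRateAssembly`, modifies nothing; decls marked «adapted» come from
unit b01 gen 16's UNCLAIMED scratch `act-iface/Sketch.lean`, with thanks)

HONEST FRAMING (cell `pub-balaban`, T4-DAG PAGE 1). The cell's T4 target is the existence AND uniqueness of the continuum limit of Bałaban's
unit-scale averaged loop expectations on a FIXED finite torus — strictly beyond ultraviolet stability ([Balaban1988Convergent] Cor. 3 p. 264;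
[Balaban1989LargeFieldII] Thm 1 p. 355), NOT infinite volume, NOT a mass gap, NOT the Clay problem. This module is a TYPING making ONE edge of the
cell's own two-run matching design stateable: the young two-run RATE binder `hAB`/`hrate` of `T4TwoRunRateAssembly.discrepancy_budget_le_graded` /
`_young_add_old` — `‖F_A(Z) − F_B(Z)‖ ≤ ε(Z)·A e^{−R d(Z)}` on the discrepant sub-catalogue — bounds ACTIVITIES, which are ABSTRACT (`w : Dom → ℂ`)
in every tree module, while unit pv06's comparison in the territory currency d′ is typed on history WEIGHTS / fibre densities. NOTHING of Bałaban's
estimates is proved here; the one analytic field is a BINDER.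

WHAT IS TYPED, AND ITS HONEST SCOPE (located; cell GAPS C-pv06g12-1). (a) `ActivityInterface` (§1): a run assigns a datum `f i : Fac` to every
structure SLOT `i` (abstract `Fac`), polymer `Z` reads the slots `host Z` it hosts, and `Φ Z f ω : ℂ` is its activity on the COMMON background `ω`
(synchronisation = node U5a, not here); ONE analytic field: `Φ Z · ω` is Lipschitz in the hosted data for a slot GAUGE, uniformly in `ω`, in the
`M Z = A e^{−R d(Z)}`-weighted norm, constant `L` = the two-run half of the cell's NE-R1 in the referee's re-scoping (`t4/T4-REF-U5.md` (0.3)/F1; NOT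
PRINTED — print never subtracts two runs, F2). The modelling choice «F(Z) = Φ(slot data, background)» is itself NOT PRINTED. LOCALITY of the
discrepancy (pv05's `hzero`) is DERIVED (`eq_of_agree`), the graded rate is `ε Z = L·Σ_{i∈host Z} δ i` for slot gauges `δ` (`norm_sub_le_of_gauge`,
young form `norm_sub_le_young`), and §2 IS pv05's budget with these inputs (`discrepancy_budget_of_interface`, by name). (b) WHAT pv06's MODULE
SUPPLIES (§3, numeric slots): two domination SHAPES bounding the gauge `|f_A i − f_B i|`, each explicit in the d′-currency — the PRICE shape (both
runs' insertion ratios lie in `[0, wabs·e^{(c_g+c_a+c_b+c_m)·cost}]`, per run the CONCLUSION of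
`T4TerritoryComparison.pointwiseRatio_of_territory_dPrime` via `ratio_mem_of_pointwiseRatio`; `hrate_of_territoryRatio`, ε = L·Σ price: SIZE-type,
small only if `wabs` is) and the two-sided RATIO shape (`e^{−δ} f_B ≤ f_A ≤ e^{δ} f_B` with `δ = (c_b^A + c_b^B)·cost + slack^A + slack^B`, from TWO
of pv06's ONE-RUN `TerritoryComparison` binders through their COMMON reference normalisation, `twoSided_of_common_norm`; `hrate_of_twoSidedRatio`, ε
= L·Σ δ: WEIGHT-size, a loss as large as the d′-cost itself). VERDICT: pv06's comparison gives the young rate its SHAPE and its currency, NOT its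
smallness; a rate small (geometric) in the run difference needs a modulus of the slot data in the RUN PARAMETERS — so the young RATE reduces to TWO
named NOT-PRINTED inputs, the interface constant `L` AND a small slot gauge, both halves of NE-R1 (cf. unit b01 gen 16's note, journal l.46527–46528). (c)
THE LOCATED NEGATIVE (§5; the row's «why it might fail» made precise): Bałaban's activities (1.91) apply the pending OPERATIONS T′_k(X_{j_h}) to the
Mayer integrand — they are multilinear in operations, not functions of the numbers T′_k(X)1; kernel fact `not_factorsThroughMass`: on a two-point
fibre two admissible densities of equal mass integrate one observable `|G| ≤ 1` differently, so NO numeric-factor typing hosts such an activity. The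
extra datum that breaks the reduction is the slot's NORMALISED FIBRE DENSITY (the operation's conditional law given the background); the REPAIRED
type is `densityProduct` (§4: slot data = densities, gauge = ℓ¹ distance, Lipschitz with `L = 1` by the positivity format of (1.73)), and pv06's
FIBREWISE two-sided ratio feeds its gauge (`l1_le_of_twoSided`, ≤ 2δ). NOT typed here: several operations composed inside one t-integral and the
sums Σ′ over {X_j}, 𝐃 of (1.91) (all in the background slot `ω`).

CITATION HEADER (quotation boundary). The ONLY sentences of [Balaban 1983–89] quoted in this module — READ AS IMAGES (renders of the journal pages),
quoted for LOCATION / FORMAT only, nothing inferred from them is asserted: [Balaban1989LargeFieldII] T. Bałaban, *Large field renormalization. II.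
Localization, exponentiation, and bounds for the 𝐑 operation*, Commun. Math. Phys. **122** (1989) 355–392 — p. 388: «where the activities F(X′) are
defined by» [(1.91): F(X′) = a sum over q, over families {X_{j_1},…,X_{j_q}} and over 𝐃 of t-integrals of ∏_{h=1}^{q} 𝐓′_k(X_{j_h}) applied to
∏_{Y∈𝐃}V(Y) exp Σ_{Y∈𝐃} t(Y)V(Y)] «Here the summation is over {X_{j_1},…,X_{j_q}} and 𝐃 such that the connected localization domain they determine
is equal to X′. To get a convergent exponentiated expansion of the right-hand side of (1.90), we have to obtain the bounds for the activities. Using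
(1.68), (1.73), (1.89), we obtain» [(1.92)] «and we have estimated the expression |σ| in (1.73) by 1.»; p. 380: «exponential density in the integral
is positive. This implies the inequalities» [(1.73): |𝐓′_k(X,(𝐔,𝐉))F| = |𝐓′_k(X,(U,0))e^{σ}F| ≤ 𝐓′_k(X,(U,0))|e^{σ}F| ≤ (𝐓′_k(X,(U,0))1) sup
e^{|σ|}|F|] «where σ is the small term of the first order in A′, 𝐉, and F is a function of the integration variables in the integral (1.71).»; p.
392 (also certified in unit pv06's `T4TerritoryComparison` header): «These functions depend only on the new field variables V_k restricted to Y_i,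
therefore they do not participate in operations connected with next renormalization transformations.» Locations only, via the certified headers of
the imports: p. 390 (1.97)–(1.100) (one-run, age-free activity / 𝐑′ bounds; `B16Exp198TwoRun`, `T4TwoRunRateAssembly`), pp. 391–392 (1.103)/(1.104)
(`T4TerritoryComparison`). ABSOLUTE RULE: the Lipschitz field, every domination binder and the modelling choice are HYPOTHESES / structure fields;
no manuscript under audit is cited for a disputed step; no programme-internal claim is cited.

DICTIONARY. `Dom` = polymers of the gas (1.90) at one step, `Λ ⊇ S` = catalogue ⊇ discrepant sub-catalogue, `out`, `d`, `A`, `R`, (1.26)_rel,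
`VolBound` as in `T4TwoRunRateAssembly`; `Slot` = structure slots (young large-field structures with their territories), `host Z` = those `Z` meets;
`Fac` = slot data (`ℝ`: a territory factor / insertion ratio; `X → ℝ`: a fibre density); `Bg` = background (new fields on and next to the
territories, Mayer data, t-parameters); `gauge` = slot-level two-run discrepancy; `L` = NE-R1's two-run half. pv06 side: `SwitchOff`,
`PointwiseRatio`, `FibreModel`, `TerritoryFactorisation`, `TerritoryComparison`, `SlackDPrime` by name.

CONTENTS. §1 `ActivityInterface`, `eq_of_agree`, `norm_sub_le_of_gauge`, `norm_sub_le_young`. §2 `discrepancy_budget_of_interface` (= pv05's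
`discrepancy_budget_le_graded` ∘ §1). §3 `ActivityInterface.Numeric`, `abs_sub_le_of_le_price`, `abs_sub_le_of_twoSided`,
`ratio_mem_of_pointwiseRatio` (adapted), `hrate_of_territoryRatio`, `hrate_of_twoSidedRatio`, `twoSided_of_common_norm`. §4 `abs_prod_sub_prod_le`
(adapted), `productInterface` (L = 1), `numericProduct` (+ `_numeric`), `densAdm`, `densityProduct`, `l1_le_of_twoSided`. §5
`exists_sameMass_integral_ne`, `not_factorsThroughMass`. §6 sanity `example`s (a NONZERO discrepancy saturating the bound; pv06's four binders
discharge the price domination per run — adapted). Everything is [folklore] finite real analysis; Mathlib + the two imports only.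

Value = a typed interface + two honest size verdicts + a located negative with its repaired type, NOT summit progress.
-/

open Finset

namespace Literature.MathematicalPhysics.QuantumFieldTheory.Balaban1983to89.T4ActivityInterface

open T4HistoryPeeling T4InsertionProfile T4TerritoryComparison T4TwoRunRateAssembly B13FamilySum

/-! ## §1 The interface: an activity functional of SLOT DATA with ONE analytic field -/

/-- **ACTIVITY INTERFACE (typing; the field `lipschitz` is the located NOT-PRINTED estimate — the two-run half of the cell's NE-R1, its
constant the NAMED BINDER `L`).**  `host Z` = the structure slots polymer `Z` reads; a RUN assigns a datum `f i : Fac` to every slot (`Fac`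
abstract: a number, a fibre density, …); `adm` = admissible data; `gauge` = the slot-level two-run discrepancy (`gauge a a = 0`); `Φ Z f ω` = the
activity of `Z` in run `f` on the COMMON background `ω`; ONE analytic field: `Φ Z · ω` is Lipschitz in the hosted data for the gauge, uniformly
in `ω`, in the `M Z`-weighted norm (`M Z = A e^{−R d(Z)}` for the consumers). [folklore] -/
structure ActivityInterface (Dom Slot Fac Bg : Type*) (M : Dom → ℝ) where
  /-- the slots hosted by a polymer -/
  host : Dom → Finset Slot
  /-- admissible slot data -/
  adm : Set Fac
  /-- the slot-level two-run gauge, vanishing on the diagonal -/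
  gauge : Fac → Fac → ℝ
  gauge_self : ∀ a, gauge a a = 0
  /-- the activity functional: polymer → run (slot data) → background → ℂ -/
  Φ : Dom → (Slot → Fac) → Bg → ℂ
  /-- the Lipschitz constant (NE-R1's two-run half; a binder) -/
  L : ℝ
  L_nonneg : 0 ≤ L
  /-- THE analytic field -/
  lipschitz : ∀ (Z : Dom) (f g : Slot → Fac) (ω : Bg), (∀ i ∈ host Z, f i ∈ adm) → (∀ i ∈ host Z, g i ∈ adm) →
    ‖Φ Z f ω - Φ Z g ω‖ ≤ L * (∑ i ∈ host Z, gauge (f i) (g i)) * M Z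

namespace ActivityInterface

variable {Dom Slot Fac Bg : Type*} {M : Dom → ℝ} (I : ActivityInterface Dom Slot Fac Bg M)

/-- **LOCALITY IS DERIVED**: two runs with the same admissible data on the slots `Z` hosts have the same activity at `Z` (the consumers'
`hzero` off the discrepant sub-catalogue). [folklore] -/
theorem eq_of_agree {Z : Dom} {f g : Slot → Fac} (ω : Bg) (hf : ∀ i ∈ I.host Z, f i ∈ I.adm) (hg : ∀ i ∈ I.host Z, g i ∈ I.adm)
    (hfg : ∀ i ∈ I.host Z, f i = g i) : I.Φ Z f ω = I.Φ Z g ω := by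
  have h0 : ∑ i ∈ I.host Z, I.gauge (f i) (g i) = 0 := Finset.sum_eq_zero fun i hi => by rw [hfg i hi, I.gauge_self]
  have h := I.lipschitz Z f g ω hf hg
  rw [h0, mul_zero, zero_mul] at h
  exact sub_eq_zero.1 (norm_le_zero_iff.1 h)

/-- **GAUGE ⇒ GRADED RATE**: slot gauges `≤ δ i` on `host Z` give the consumers' `hAB` shape with `ε Z = L · Σ_{i ∈ host Z} δ i`. [folklore] -/
theorem norm_sub_le_of_gauge (hM : ∀ Z, 0 ≤ M Z) {Z : Dom} {f g : Slot → Fac} (ω : Bg) {δ : Slot → ℝ} (hf : ∀ i ∈ I.host Z, f i ∈ I.adm)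
    (hg : ∀ i ∈ I.host Z, g i ∈ I.adm) (hδ : ∀ i ∈ I.host Z, I.gauge (f i) (g i) ≤ δ i) :
    ‖I.Φ Z f ω - I.Φ Z g ω‖ ≤ (I.L * ∑ i ∈ I.host Z, δ i) * M Z :=
  (I.lipschitz Z f g ω hf hg).trans (mul_le_mul_of_nonneg_right (mul_le_mul_of_nonneg_left (Finset.sum_le_sum hδ) I.L_nonneg) (hM Z))

/-- **… YOUNG form**: a uniform slot budget `Σ_{i ∈ host Z} δ i ≤ δ₀` on the young discrepant polymers gives the `hrate` binder of
`T4TwoRunRateAssembly.discrepancy_budget_le_young_add_old` with `r = L · δ₀`. [folklore] -/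
theorem norm_sub_le_young (hM : ∀ Z, 0 ≤ M Z) {S : Finset Dom} (Young : Dom → Prop) {f g : Slot → Fac} (ω : Bg) {δ : Slot → ℝ} {δ₀ : ℝ}
    (hf : ∀ Z ∈ S, ∀ i ∈ I.host Z, f i ∈ I.adm) (hg : ∀ Z ∈ S, ∀ i ∈ I.host Z, g i ∈ I.adm)
    (hδ : ∀ Z ∈ S, ∀ i ∈ I.host Z, I.gauge (f i) (g i) ≤ δ i) (hδ₀ : ∀ Z ∈ S, Young Z → ∑ i ∈ I.host Z, δ i ≤ δ₀) :
    ∀ Z ∈ S, Young Z → ‖I.Φ Z f ω - I.Φ Z g ω‖ ≤ I.L * δ₀ * M Z := fun Z hZ hY =>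
  (I.norm_sub_le_of_gauge hM ω (hf Z hZ) (hg Z hZ) (hδ Z hZ)).trans
    (mul_le_mul_of_nonneg_right (mul_le_mul_of_nonneg_left (hδ₀ Z hZ hY) I.L_nonneg) (hM Z))

end ActivityInterface

/-! ## §2 Composition BY NAME with unit pv05's graded budget -/

section Budget

variable {Dom Cube Slot Fac Bg : Type*} [DecidableEq Dom] [DecidableEq Cube]

/-- **THE ACTIVITY-DISCREPANCY BUDGET OF AN INTERFACE** (= `T4TwoRunRateAssembly.discrepancy_budget_le_graded`, its `hzero` DERIVED from slot
agreement off `S`, its `hAB` from the slot gauges with `ε Z = L · Σ_{i ∈ host Z} δ i`):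
**Σ_{Z∈Λ}‖Φ Z f_A ω − Φ Z f_B ω‖ e^{τ#out Z + (r₁+s)d(Z) + b} ≤ A e^{b+τc₁}·K₀·Σ_{□∈Q} e(□)**. [folklore] -/
theorem discrepancy_budget_of_interface {d : Dom → ℝ} {A R : ℝ} (I : ActivityInterface Dom Slot Fac Bg (fun Z => A * Real.exp (-(R * d Z))))
    {Λ S : Finset Dom} (hS : S ⊆ Λ) {out : Dom → Finset Cube} {r₁ s κ₀ K₀ c₁ b τ : ℝ} {δ : Slot → ℝ} {e : Cube → ℝ}
    (fA fB : Slot → Fac) (ω : Bg) (hd : ∀ Z, 0 ≤ d Z) (hA : 0 ≤ A) (hτ : 0 ≤ τ)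
    (hadmA : ∀ Z ∈ Λ, ∀ i ∈ I.host Z, fA i ∈ I.adm) (hadmB : ∀ Z ∈ Λ, ∀ i ∈ I.host Z, fB i ∈ I.adm)
    (hagree : ∀ Z ∈ Λ, Z ∉ S → ∀ i ∈ I.host Z, fA i = fB i) (hδ : ∀ Z ∈ S, ∀ i ∈ I.host Z, I.gauge (fA i) (fB i) ≤ δ i)
    (h126 : Ineq126 Λ out d κ₀ K₀) (hvol : VolBound Λ out d c₁) (hrate : κ₀ + (r₁ + s) + τ * c₁ ≤ R)
    {Q : Finset Cube} (he : ∀ q ∈ Q, 0 ≤ e q) (hQ : ∀ Z ∈ S, ∃ q ∈ Q, q ∈ out Z ∧ I.L * ∑ i ∈ I.host Z, δ i ≤ e q) :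
    ∑ Z ∈ Λ, ‖I.Φ Z fA ω - I.Φ Z fB ω‖ * Real.exp (τ * ((out Z).card : ℝ) + ((r₁ + s) * d Z + b)) ≤
      A * Real.exp (b + τ * c₁) * K₀ * ∑ q ∈ Q, e q :=
  have hM : ∀ Z, 0 ≤ A * Real.exp (-(R * d Z)) := fun _ => mul_nonneg hA (Real.exp_nonneg _)
  discrepancy_budget_le_graded hS (wA := fun Z => I.Φ Z fA ω) (wB := fun Z => I.Φ Z fB ω) (ε := fun Z => I.L * ∑ i ∈ I.host Z, δ i)
    hd hA hτ (fun Z hZ hZS => I.eq_of_agree ω (hadmA Z hZ) (hadmB Z hZ) (hagree Z hZ hZS))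
    (fun Z hZ => I.norm_sub_le_of_gauge hM ω (hadmA Z (hS hZ)) (hadmB Z (hS hZ)) (hδ Z hZ)) h126 hvol hrate he hQ

end Budget

/-! ## §3 NUMERIC slot data: the two domination shapes bounding the gauge, and their source in unit pv06's module -/

section Numeric

variable {Dom Slot Bg : Type*} {M : Dom → ℝ}

/-- A NUMERIC interface: real slot data, the unit interval admissible, the gauge dominated there by `|a − b|`. [folklore] -/
structure ActivityInterface.Numeric (I : ActivityInterface Dom Slot ℝ Bg M) : Prop where
  adm_Icc : Set.Icc (0 : ℝ) 1 ⊆ I.adm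
  gauge_le : ∀ a ∈ Set.Icc (0 : ℝ) 1, ∀ b ∈ Set.Icc (0 : ℝ) 1, I.gauge a b ≤ |a - b|

/-- (PRICE shape) two data in `[0, p]` differ by at most `p` — SIZE-type: small only if the price is. [folklore] -/
theorem abs_sub_le_of_le_price {a b p : ℝ} (ha : 0 ≤ a ∧ a ≤ p) (hb : 0 ≤ b ∧ b ≤ p) : |a - b| ≤ p := by
  rw [abs_le]; constructor <;> linarith [ha.1, ha.2, hb.1, hb.2]

/-- (RATIO shape) two data in `[0, 1]` with the TWO-SIDED ratio `e^{−δ} b ≤ a ≤ e^{δ} b`, `δ ≥ 0`, differ by at most `δ` (`1 − e^{−δ} ≤ δ`). [folklore] -/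
theorem abs_sub_le_of_twoSided {a b δ : ℝ} (ha : a ∈ Set.Icc (0 : ℝ) 1) (hb : b ∈ Set.Icc (0 : ℝ) 1) (hδ : 0 ≤ δ) (h₁ : Real.exp (-δ) * b ≤ a)
    (h₂ : a ≤ Real.exp δ * b) : |a - b| ≤ δ := by
  have hE : 1 - Real.exp (-δ) ≤ δ := by linarith [Real.add_one_le_exp (-δ)]
  have h₂' : Real.exp (-δ) * a ≤ b := (mul_le_mul_of_nonneg_left h₂ (Real.exp_nonneg _)).trans_eq
    (by rw [← mul_assoc, ← Real.exp_add, neg_add_cancel, Real.exp_zero, one_mul])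
  rw [abs_le]
  constructor
  · have : b - a ≤ (1 - Real.exp (-δ)) * b := by nlinarith [hb.1]
    nlinarith [hb.1, hb.2]
  · have : a - b ≤ (1 - Real.exp (-δ)) * a := by nlinarith [ha.1]
    nlinarith [ha.1, ha.2]

/-- **THE INSERTION RATIO as slot datum** (unit pv06's CONCLUSION shape `T4InsertionProfile.PointwiseRatio`, by name): for a term `τ` pending at `i`
with positive context weight, `A τ / A (off i τ) ∈ [0, y i (shape i τ)]`.  (Adapted from unit b01's unclaimed scratch.) [folklore] -/
theorem ratio_mem_of_pointwiseRatio {ι σ : Type*} {T : Finset ι} {n : ℕ} (Φ : SwitchOff T n) {Aw : ι → ℝ} {shape : Fin n → ι → σ}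
    {y : Fin n → σ → ℝ} (hP : PointwiseRatio Φ Aw shape y) (hA0 : ∀ τ ∈ T, 0 ≤ Aw τ) {i : Fin n} {τ : ι} (hτ : τ ∈ T)
    (hp : Φ.pend i τ = true) (hpos : 0 < Aw (Φ.off i τ)) : 0 ≤ Aw τ / Aw (Φ.off i τ) ∧ Aw τ / Aw (Φ.off i τ) ≤ y i (shape i τ) :=
  ⟨div_nonneg (hA0 τ hτ) hpos.le, (div_le_iff₀ hpos).2 (hP i τ hτ hp)⟩

/-- **`hrate` FROM THE TERRITORY PRICE** (row item (2), PRICE reading): in a numeric interface, if BOTH runs' data on the slots of `Z ∈ S` lie in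
`[0, p i]`, `p i ≤ 1` — per run the conclusion of unit pv06's `T4TerritoryComparison.pointwiseRatio_of_territory_dPrime` read through
`ratio_mem_of_pointwiseRatio`, price `p = wabs·exp((c_g+c_a+c_b+c_m)·cost)` in the d′-currency — then the consumers' `hAB` holds with
**ε Z = L · Σ_{i ∈ host Z} p i**: explicit in `L`, the price constants and the d′-cost; SIZE-type (HONEST SCOPE (b)). [folklore] -/
theorem hrate_of_territoryRatio (I : ActivityInterface Dom Slot ℝ Bg M) (hN : I.Numeric) (hM : ∀ Z, 0 ≤ M Z) {S : Finset Dom} {fA fB : Slot → ℝ}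
    (ω : Bg) {p : Slot → ℝ} (hdomA : ∀ Z ∈ S, ∀ i ∈ I.host Z, 0 ≤ fA i ∧ fA i ≤ p i) (hdomB : ∀ Z ∈ S, ∀ i ∈ I.host Z, 0 ≤ fB i ∧ fB i ≤ p i)
    (hp1 : ∀ Z ∈ S, ∀ i ∈ I.host Z, p i ≤ 1) : ∀ Z ∈ S, ‖I.Φ Z fA ω - I.Φ Z fB ω‖ ≤ (I.L * ∑ i ∈ I.host Z, p i) * M Z := fun Z hZ =>
  have hIA : ∀ i ∈ I.host Z, fA i ∈ Set.Icc (0 : ℝ) 1 := fun i hi => ⟨(hdomA Z hZ i hi).1, (hdomA Z hZ i hi).2.trans (hp1 Z hZ i hi)⟩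
  have hIB : ∀ i ∈ I.host Z, fB i ∈ Set.Icc (0 : ℝ) 1 := fun i hi => ⟨(hdomB Z hZ i hi).1, (hdomB Z hZ i hi).2.trans (hp1 Z hZ i hi)⟩
  I.norm_sub_le_of_gauge hM ω (fun i hi => hN.adm_Icc (hIA i hi)) (fun i hi => hN.adm_Icc (hIB i hi))
    fun i hi => (hN.gauge_le _ (hIA i hi) _ (hIB i hi)).trans (abs_sub_le_of_le_price (hdomA Z hZ i hi) (hdomB Z hZ i hi))

/-- **`hrate` FROM A TWO-RUN TERRITORY RATIO** (row item (2), RATIO reading): in a numeric interface, if the two runs' data on the slots of `Z ∈ S`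
lie in `[0, 1]` and compare TWO-SIDEDLY, `e^{−δ i} f_B i ≤ f_A i ≤ e^{δ i} f_B i`, `δ i ≥ 0` (the shape `twoSided_of_common_norm` extracts from TWO
of unit pv06's `TerritoryComparison` binders with a common reference normalisation: `δ = (c_b^A + c_b^B)·cost + slack^A + slack^B` in the
d′-currency), then the consumers' `hAB` holds with **ε Z = L · Σ_{i ∈ host Z} δ i** — explicit in `(L, the ratio's slack, d′)`; WEIGHT-size, NOT
small (HONEST SCOPE (b)). [folklore] -/
theorem hrate_of_twoSidedRatio (I : ActivityInterface Dom Slot ℝ Bg M) (hN : I.Numeric) (hM : ∀ Z, 0 ≤ M Z) {S : Finset Dom} {fA fB : Slot → ℝ}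
    (ω : Bg) {δ : Slot → ℝ} (hIA : ∀ Z ∈ S, ∀ i ∈ I.host Z, fA i ∈ Set.Icc (0 : ℝ) 1) (hIB : ∀ Z ∈ S, ∀ i ∈ I.host Z, fB i ∈ Set.Icc (0 : ℝ) 1)
    (hδ : ∀ Z ∈ S, ∀ i ∈ I.host Z, 0 ≤ δ i) (htwo : ∀ Z ∈ S, ∀ i ∈ I.host Z, Real.exp (-δ i) * fB i ≤ fA i ∧ fA i ≤ Real.exp (δ i) * fB i) :
    ∀ Z ∈ S, ‖I.Φ Z fA ω - I.Φ Z fB ω‖ ≤ (I.L * ∑ i ∈ I.host Z, δ i) * M Z := fun Z hZ =>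
  I.norm_sub_le_of_gauge hM ω (fun i hi => hN.adm_Icc (hIA Z hZ i hi)) (fun i hi => hN.adm_Icc (hIB Z hZ i hi)) fun i hi =>
    (hN.gauge_le _ (hIA Z hZ i hi) _ (hIB Z hZ i hi)).trans
      (abs_sub_le_of_twoSided (hIA Z hZ i hi) (hIB Z hZ i hi) (hδ Z hZ i hi) (htwo Z hZ i hi).1 (htwo Z hZ i hi).2)

/-- **TWO RUNS THROUGH A COMMON REFERENCE (unit pv06's binder, by name).**  `TerritoryComparison` is a ONE-RUN two-sided comparison of a run's
conditional territory integral `terr` with the reference normalisation `norm` the pending operation divides out; two runs factorised over the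
SAME switch-off system with a COMMON `norm` therefore compare with each other two-sidedly with the SUM of their losses,
`δ = (c_b^A + c_b^B)·cost + slack^A + slack^B` — a loss of the size of the d′-cost itself (K-uniform, NOT small: HONEST SCOPE (b)). [folklore] -/
theorem twoSided_of_common_norm {ι σ Ω : Type*} [MeasurableSpace Ω] {T : Finset ι} {n : ℕ} {Φ : SwitchOff T n} {AwA AwB : ι → ℝ}
    {μ : MeasureTheory.Measure Ω} {FA : FibreModel T AwA μ} {FB : FibreModel T AwB μ} {XA : TerritoryFactorisation Φ FA}
    {XB : TerritoryFactorisation Φ FB} {shape : Fin n → ι → σ} {cost : Fin n → σ → ℝ} {cbA cbB : ℝ} {slackA slackB : Fin n → σ → ℝ}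
    (hA : TerritoryComparison Φ XA shape cost cbA slackA) (hB : TerritoryComparison Φ XB shape cost cbB slackB)
    (hnorm : ∀ i, ∀ τ ∈ T, ∀ ω, XA.norm i τ ω = XB.norm i τ ω) :
    ∀ i : Fin n, ∀ τ ∈ T, Φ.pend i τ = true → ∀ ω,
      Real.exp (-((cbA + cbB) * cost i (shape i τ) + (slackA i (shape i τ) + slackB i (shape i τ)))) * XB.terr i τ ω ≤ XA.terr i τ ω ∧
      XA.terr i τ ω ≤ Real.exp ((cbA + cbB) * cost i (shape i τ) + (slackA i (shape i τ) + slackB i (shape i τ))) * XB.terr i τ ω := by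
  intro i τ hτ hp ω
  obtain ⟨hA1, hA2⟩ := hA i τ hτ hp ω
  obtain ⟨hB1, hB2⟩ := hB i τ hτ hp ω
  rw [← hnorm i τ hτ ω] at hB1 hB2
  set a := cbA * cost i (shape i τ) + slackA i (shape i τ)
  set c := cbB * cost i (shape i τ) + slackB i (shape i τ)
  have hN1 : Real.exp (-c) * XB.terr i τ ω ≤ XA.norm i τ ω := (mul_le_mul_of_nonneg_left hB2 (Real.exp_nonneg _)).trans_eq
    (by rw [← mul_assoc, ← Real.exp_add, neg_add_cancel, Real.exp_zero, one_mul])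
  have hN2 : XA.norm i τ ω ≤ Real.exp c * XB.terr i τ ω := by
    have h := mul_le_mul_of_nonneg_left hB1 (Real.exp_nonneg c)
    rwa [← mul_assoc, ← Real.exp_add, add_neg_cancel, Real.exp_zero, one_mul] at h
  rw [show (cbA + cbB) * cost i (shape i τ) + (slackA i (shape i τ) + slackB i (shape i τ)) = a + c by ring, neg_add, Real.exp_add,
    Real.exp_add, mul_assoc, mul_assoc]
  exact ⟨(mul_le_mul_of_nonneg_left hN1 (Real.exp_nonneg _)).trans hA1, hA2.trans (mul_le_mul_of_nonneg_left hN2 (Real.exp_nonneg _))⟩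

end Numeric

/-! ## §4 NON-TRIVIAL INSTANCES: products of slot functionals (telescoping), numeric and DENSITY slots -/

section Instances

/-- Telescoping on the unit box: `|∏ f − ∏ g| ≤ Σ |f − g|`. (Adapted from unit b01's unclaimed scratch.) [folklore] -/
theorem abs_prod_sub_prod_le {k : Type*} (s : Finset k) (f g : k → ℝ) (hf : ∀ c ∈ s, |f c| ≤ 1) (hg : ∀ c ∈ s, |g c| ≤ 1) :
    |∏ c ∈ s, f c - ∏ c ∈ s, g c| ≤ ∑ c ∈ s, |f c - g c| := by
  classical
  induction s using Finset.induction_on with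
  | empty => simp
  | @insert a s ha ih =>
    have hf' : ∀ c ∈ s, |f c| ≤ 1 := fun c hc => hf c (mem_insert_of_mem hc)
    have hg' : ∀ c ∈ s, |g c| ≤ 1 := fun c hc => hg c (mem_insert_of_mem hc)
    have hPf : |∏ c ∈ s, f c| ≤ 1 := by rw [Finset.abs_prod]; exact prod_le_one (fun c _ => abs_nonneg _) hf'
    rw [prod_insert ha, prod_insert ha, sum_insert ha,
      show f a * ∏ c ∈ s, f c - g a * ∏ c ∈ s, g c = (f a - g a) * ∏ c ∈ s, f c + g a * (∏ c ∈ s, f c - ∏ c ∈ s, g c) by ring]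
    refine (abs_add_le _ _).trans ?_
    rw [abs_mul, abs_mul]
    have t1 : |f a - g a| * |∏ c ∈ s, f c| ≤ |f a - g a| := mul_le_of_le_one_right (abs_nonneg _) hPf
    have t2 : |g a| * |∏ c ∈ s, f c - ∏ c ∈ s, g c| ≤ ∑ c ∈ s, |f c - g c| :=
      (mul_le_of_le_one_left (abs_nonneg _) (hg a (mem_insert_self a s))).trans (ih hf' hg')
    linarith

variable {Dom Slot Fac Bg : Type*}

/-- **THE PRODUCT INTERFACE over slot functionals.**  `Φ Z f ω := amp Z ω · ∏_{i ∈ host Z} ψ i (f i) ω` with a background amplitude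
`‖amp Z ω‖ ≤ M Z` and real slot functionals `ψ i` bounded by `1` on admissible data and `gauge`-Lipschitz: an `ActivityInterface` with `L = 1` by
telescoping — the structure is inhabited WITH CONTENT. [folklore] -/
noncomputable def productInterface (host : Dom → Finset Slot) (adm : Set Fac) (gauge : Fac → Fac → ℝ) (gauge_self : ∀ a, gauge a a = 0)
    (M : Dom → ℝ) (amp : Dom → Bg → ℂ) (hamp : ∀ Z ω, ‖amp Z ω‖ ≤ M Z) (ψ : Slot → Fac → Bg → ℝ) (hψ1 : ∀ i a ω, a ∈ adm → |ψ i a ω| ≤ 1)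
    (hψL : ∀ i a b ω, a ∈ adm → b ∈ adm → |ψ i a ω - ψ i b ω| ≤ gauge a b) : ActivityInterface Dom Slot Fac Bg M where
  host := host
  adm := adm
  gauge := gauge
  gauge_self := gauge_self
  Φ := fun Z f ω => amp Z ω * ((∏ i ∈ host Z, ψ i (f i) ω : ℝ) : ℂ)
  L := 1
  L_nonneg := zero_le_one
  lipschitz := by
    intro Z f g ω hf hg
    rw [← mul_sub, norm_mul, ← Complex.ofReal_sub, Complex.norm_real, Real.norm_eq_abs, one_mul]
    have ht : |∏ i ∈ host Z, ψ i (f i) ω - ∏ i ∈ host Z, ψ i (g i) ω| ≤ ∑ i ∈ host Z, gauge (f i) (g i) :=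
      (abs_prod_sub_prod_le (host Z) (fun i => ψ i (f i) ω) (fun i => ψ i (g i) ω) (fun i hi => hψ1 i _ ω (hf i hi))
        (fun i hi => hψ1 i _ ω (hg i hi))).trans (Finset.sum_le_sum fun i hi => hψL i _ _ ω (hf i hi) (hg i hi))
    calc ‖amp Z ω‖ * |∏ i ∈ host Z, ψ i (f i) ω - ∏ i ∈ host Z, ψ i (g i) ω| ≤ M Z * ∑ i ∈ host Z, gauge (f i) (g i) :=
          mul_le_mul (hamp Z ω) ht (abs_nonneg _) ((norm_nonneg _).trans (hamp Z ω))
      _ = (∑ i ∈ host Z, gauge (f i) (g i)) * M Z := mul_comm _ _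

/-- **NUMERIC slots** (row item (3)): data in `[0, 1]`, gauge `|a − b|`, `ψ i a ω = a` — a finite product of the hosted territory factors times a
background amplitude, Lipschitz with `L = 1`. [folklore] -/
noncomputable def numericProduct (host : Dom → Finset Slot) (M : Dom → ℝ) (amp : Dom → Bg → ℂ) (hamp : ∀ Z ω, ‖amp Z ω‖ ≤ M Z) :
    ActivityInterface Dom Slot ℝ Bg M :=
  productInterface host (Set.Icc 0 1) (fun a b => |a - b|) (fun a => by simp) M amp hamp (fun _ a _ => a)
    (fun _ a _ ha => abs_le.2 ⟨by linarith [ha.1], ha.2⟩) (fun _ _ _ _ _ _ => le_rfl)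

/-- The numeric product IS a numeric interface (so `hrate_of_territoryRatio` / `hrate_of_twoSidedRatio` apply to it). [folklore] -/
theorem numericProduct_numeric (host : Dom → Finset Slot) (M : Dom → ℝ) (amp : Dom → Bg → ℂ) (hamp : ∀ Z ω, ‖amp Z ω‖ ≤ M Z) :
    (numericProduct host M amp hamp).Numeric :=
  ⟨fun _ ha => ha, fun _ _ _ _ => le_rfl⟩

/-- Admissible DENSITY data on a finite fibre `X`: non-negative with mass `≤ 1`. [folklore] -/
def densAdm (X : Type*) [Fintype X] : Set (X → ℝ) := {a | (∀ x, 0 ≤ a x) ∧ ∑ x, a x ≤ 1}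

/-- **DENSITY slots (the REPAIRED TYPE of the located negative, §5)**: a slot datum is a fibre density `a : X → ℝ` (the normalised density of the
slot's pending OPERATION over its territory variables), the gauge is the ℓ¹ distance `Σ_x |a x − b x|`, and `ψ i a ω = Σ_x a x · G i ω x`
integrates a background observable `|G| ≤ 1` — the positivity format |𝐓′F| ≤ (𝐓′1)·sup|F| of (1.73) p. 380.  Product interface, `L = 1`. [folklore] -/
noncomputable def densityProduct {X : Type*} [Fintype X] (host : Dom → Finset Slot) (M : Dom → ℝ) (amp : Dom → Bg → ℂ)
    (hamp : ∀ Z ω, ‖amp Z ω‖ ≤ M Z) (G : Slot → Bg → X → ℝ) (hG : ∀ i ω x, |G i ω x| ≤ 1) : ActivityInterface Dom Slot (X → ℝ) Bg M :=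
  productInterface host (densAdm X) (fun a b => ∑ x, |a x - b x|) (fun a => by simp) M amp hamp (fun i a ω => ∑ x, a x * G i ω x)
    (fun i a ω ha => (Finset.abs_sum_le_sum_abs _ _).trans (le_trans (Finset.sum_le_sum fun x _ => by
      rw [abs_mul, abs_of_nonneg (ha.1 x)]; exact mul_le_of_le_one_right (ha.1 x) (hG i ω x)) ha.2))
    (fun i a b ω _ _ => by
      rw [← Finset.sum_sub_distrib]
      refine (Finset.abs_sum_le_sum_abs _ _).trans (Finset.sum_le_sum fun x _ => ?_)
      rw [← sub_mul, abs_mul]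
      exact mul_le_of_le_one_right (abs_nonneg _) (hG i ω x))

/-- FIBREWISE two-sided ratio ⇒ ℓ¹ gauge (unit pv06's fibrewise language feeds the repaired type): densities with `e^{−δ} b x ≤ a x ≤ e^{δ} b x`
pointwise, `δ ≥ 0`, are within `δ·(mass a + mass b) ≤ 2δ` in ℓ¹. [folklore] -/
theorem l1_le_of_twoSided {X : Type*} [Fintype X] {a b : X → ℝ} {δ : ℝ} (ha : a ∈ densAdm X) (hb : b ∈ densAdm X) (hδ : 0 ≤ δ)
    (h : ∀ x, Real.exp (-δ) * b x ≤ a x ∧ a x ≤ Real.exp δ * b x) : ∑ x, |a x - b x| ≤ 2 * δ := by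
  have hE : 1 - Real.exp (-δ) ≤ δ := by linarith [Real.add_one_le_exp (-δ)]
  have hx : ∀ x, |a x - b x| ≤ δ * (a x + b x) := fun x => by
    obtain ⟨h₁, h₂⟩ := h x
    have h₂' : Real.exp (-δ) * a x ≤ b x := (mul_le_mul_of_nonneg_left h₂ (Real.exp_nonneg _)).trans_eq
      (by rw [← mul_assoc, ← Real.exp_add, neg_add_cancel, Real.exp_zero, one_mul])
    rw [abs_le]; constructor <;> nlinarith [ha.1 x, hb.1 x, Real.exp_nonneg (-δ)]
  calc ∑ x, |a x - b x| ≤ ∑ x, δ * (a x + b x) := Finset.sum_le_sum fun x _ => hx x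
    _ = δ * (∑ x, a x + ∑ x, b x) := by rw [← Finset.mul_sum, Finset.sum_add_distrib]
    _ ≤ 2 * δ := by nlinarith [ha.2, hb.2]

end Instances

/-! ## §5 THE LOCATED NEGATIVE: an operation's activity is NOT a function of its numeric territory factor (its mass) -/

section Negative

/-- Two admissible densities on the two-point fibre with EQUAL MASS whose integrals against one observable `|G| ≤ 1` DIFFER: the slot functional
of `densityProduct` does not factor through the mass `Σ_x a x` — the number 𝐓′(Y)1 of a pending operation does not determine the operation's
action on non-constant integrands. [folklore] -/
theorem exists_sameMass_integral_ne : ∃ (G : Bool → ℝ) (a b : Bool → ℝ), (∀ x, |G x| ≤ 1) ∧ a ∈ densAdm Bool ∧ b ∈ densAdm Bool ∧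
    ∑ x, a x = ∑ x, b x ∧ ∑ x, a x * G x ≠ ∑ x, b x * G x := by
  refine ⟨fun x => if x then 1 else 0, fun x => if x then 1 else 0, fun x => if x then 0 else 1, fun x => ?_, ⟨fun x => ?_, ?_⟩,
    ⟨fun x => ?_, ?_⟩, ?_, ?_⟩
  · cases x <;> simp
  · cases x <;> simp
  · simp
  · cases x <;> simp
  · simp
  · simp
  · simp

/-- **THE NEGATIVE, as a non-factorisation**: NO function of the mass reproduces the density slot functional on admissible data.  Hence an
interface typed over NUMERIC territory factors alone cannot host activities that integrate the fluctuation field against the factors as part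
of the density ((1.91) p. 388 applies OPERATIONS); the extra datum breaking the reduction is the slot's normalised fibre density (its conditional
law given the background), and `densityProduct` is the repaired type. [folklore] -/
theorem not_factorsThroughMass : ∃ G : Bool → ℝ, (∀ x, |G x| ≤ 1) ∧ ¬ ∃ Ψ : ℝ → ℝ, ∀ a ∈ densAdm Bool, ∑ x, a x * G x = Ψ (∑ x, a x) := by
  obtain ⟨G, a, b, hG, ha, hb, hmass, hne⟩ := exists_sameMass_integral_ne
  refine ⟨G, hG, fun ⟨Ψ, hΨ⟩ => hne ?_⟩
  rw [hΨ a ha, hΨ b hb, hmass]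

end Negative

/-! ## §6 Sanity (examples only): a NONZERO discrepancy saturating the bound; pv06's four binders discharge the price domination per run -/

section Sanity

/-- One polymer hosting one numeric slot, runs with data `1` and `1/2`, `M = 1`, `amp = 1`: discrepancy `1/2` = `L·|1 − 1/2|·M` — the binders of
§2/§3 are jointly satisfiable with a NONZERO discrepancy and the Lipschitz bound is attained. -/
example : ‖(numericProduct (fun _ : Unit => ({()} : Finset Unit)) (fun _ => (1 : ℝ)) (fun _ (_ : Unit) => (1 : ℂ)) (fun _ _ => by simp)).Φ ()
      (fun _ => 1) () - (numericProduct (fun _ : Unit => ({()} : Finset Unit)) (fun _ => (1 : ℝ)) (fun _ (_ : Unit) => (1 : ℂ))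
      (fun _ _ => by simp)).Φ () (fun _ => 1 / 2) ()‖ = 1 / 2 := by
  simp [numericProduct, productInterface]
  norm_num

/-- Unit pv06's (F1) ∧ E2-rel (a) ∧ E2-rel (b) ∧ `SlackDPrime` discharge, PER RUN, the price domination `hdom_` of `hrate_of_territoryRatio` for the
insertion-ratio datum (composition BY NAME with `pointwiseRatio_of_territory_dPrime`; adapted from unit b01's unclaimed scratch). -/
example {ι σ Ω : Type*} [MeasurableSpace Ω] {T : Finset ι} {n : ℕ} (Φ : SwitchOff T n) {Aw : ι → ℝ} {μ : MeasureTheory.Measure Ω}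
    {F : FibreModel T Aw μ} (X : TerritoryFactorisation Φ F) (shape : Fin n → ι → σ) (cost : Fin n → σ → ℝ) {wabs : Fin n → σ → ℝ}
    {cg ca cb cm : ℝ} {slack : Fin n → σ → ℝ} (hw : ∀ i, ∀ τ ∈ T, Φ.pend i τ = true → 0 ≤ wabs i (shape i τ))
    (hF1 : OwnFactorBound Φ X shape cost wabs cg) (ha : ExteriorRelLocality Φ X shape cost ca) (hb : TerritoryLowerBound Φ X shape cost cb slack)
    (hm : SlackDPrime Φ shape cost slack cm) {i : Fin n} {τ : ι} (hτ : τ ∈ T) (hp : Φ.pend i τ = true) (hpos : 0 < Aw (Φ.off i τ)) :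
    0 ≤ Aw τ / Aw (Φ.off i τ) ∧ Aw τ / Aw (Φ.off i τ) ≤ wabs i (shape i τ) * Real.exp ((cg + ca + cb + cm) * cost i (shape i τ)) :=
  ratio_mem_of_pointwiseRatio Φ (shape := shape) (y := fun i s => wabs i s * Real.exp ((cg + ca + cb + cm) * cost i s))
    (pointwiseRatio_of_territory_dPrime F.weight_nonneg hw hF1 ha hb hm) F.weight_nonneg hτ hp hpos

end Sanity

end Literature.MathematicalPhysics.QuantumFieldTheory.Balaban1983to89.T4ActivityInterface
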